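import Summits.BirchSwinnertonDyer.BirchSwinnertonDyer.Theorems.ByReductionTypeAtTwoTowerClassKitD
import Literature.NumberTheory.EllipticCurves.CyclotomicZpExtensionLayerTwoProofs
import Literature.NumberTheory.EllipticCurves.LocalKummerIsotropyTransport
import Literature.NumberTheory.EllipticCurves.Sha
import Literature.NumberTheory.LocalFields.PadicRootsOfUnity
import HarnessLib

/-!
# TOWER road — the LAYER-`j` TORSION CERTIFICATE: `#E[2^∞]^{Gal(ℚ̄/ℚ_j)} ≤ 2^{ord₂ #Ẽ(𝔽_ℓ)}` for a
# good odd prime `ℓ ≡ 1 (mod 2^{j+2})`, and the torsion-tolerant gap door with the layer-`j` torsion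
# count DISCHARGED by a decidable point count (route ByReductionTypeAtTwo, items 19271 / 19573 /
# 19922; seat bsd-2adic-tower-1 GEN 5)

HONEST FRAMING (cell `bsd-2adic`, run/shared/lean/pub/bsd-2adic/, HUMAN RULINGS D-0036 / D-0054 / D-0074):
THEOREMS ONLY; nothing asserted; no definition; no new named fact; closes nothing by itself.

The torsion-tolerant tower-gap doors (`TowerClass.towerGapAtTwo_of_counts_of_torsion[_print]`, ord-2
GEN 4; mult-2's `MultTowerTorsion…_of_torsion`) display, at the LOWER layer `j`, the torsion count
`htor : #{m ∈ E[2^∞] : σ m = m ∀ σ ∈ Gal(ℚ̄/ℚ_j)} ≤ 2^t`. At `j = 0` KitD discharges it by a point count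
at any good odd prime (`#E(ℚ)[2^∞] ↪ Ẽ(𝔽_ℓ)`). This file discharges it at EVERY layer `j`: for a good
prime `ℓ ≥ 3` with `2^{j+2} ∣ ℓ − 1`,

  `Gal(ℚ̄/ℚ_j) ≥ Gal(ℚ̄/ℚ(μ_{2^{j+2}}))` (ord-2's `IsCyclotomic.rootsOfUnityFixer_le_layerSubgroup_two`,
  `ℚ_j = ℚ(ζ_{2^{j+2}})⁺`) `∋ res τ` for every `τ ∈ Γ_{ℚ_ℓ}` (`ℚ_ℓ ⊇ μ_{ℓ−1} ⊇ μ_{2^{j+2}}`, Hensel),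

so a point of `E[2^∞]` fixed by `Gal(ℚ̄/ℚ_j)` maps, along the chosen embedding `ℚ̄ → ℚ̄_ℓ`, to a
`Γ_{ℚ_ℓ}`-fixed point, i.e. (Galois descent over `ℚ_ℓ`) to a torsion point of `E(ℚ_ℓ)`, and
`#E(ℚ_ℓ)_tors ∣ c_ℓ · #Ẽ_ns(𝔽_ℓ) = #Ẽ(𝔽_ℓ)` (tree `LocalLog.card_torsion_baseChange_dvd`, `c_ℓ = 1`).

* §1 `resGalOfEmb_padic_mem_rootsOfUnityFixer` — `res τ ∈ Gal(ℚ̄/ℚ(μ_N))` for `τ ∈ Γ_{ℚ_ℓ}`, `N ∣ ℓ − 1`.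
* §2 `natCard_fixedBy_le_pow_of_rootsOfUnityFixer_le` — for ANY subgroup `S ≥ Gal(ℚ̄/ℚ(μ_N))` of `Γ_ℚ`
  and any prime `p`: `#{m ∈ E[p^∞] : S-fixed} ≤ p^{ord_p #Ẽ(𝔽_ℓ)}` (plus finiteness); in particular for
  `S = Gal(ℚ̄/ℚ(μ_N))` itself.
* §3 `natCard_fixedBy_layerSubgroup_le_pow_of_good` — the displayed `htor` at layer `j` of every
  cyclotomic `κ : ZpExtension ℚ 2`, from `2^{j+2} ∣ ℓ − 1` and `ord₂ #Ẽ(𝔽_ℓ) ≤ t`; `…_card` with the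
  decidable reading `#Ẽ(𝔽_ℓ) = n`, `¬ 2^{t+1} ∣ n`.
* §4 `towerGapAtTwo_of_counts_of_goodPrime_layer[_card]` — the gap door of `…TowerLayerTorsion` §2 at a
  general pair `(j, j')` with `htor` DISCHARGED: PRINT `hB` + CERT {lower Selmer count at `ℚ_j`, exact
  upper count at `ℚ_{j'}`, the prime `ℓ`, `d + t + 1 ≤ 2^{j'} − 2^j + a`}.

References: [GreenbergLNM1716] §1 p. 60/62, §3 pp. 85–86, §4 Lemma 4.3; [SilvermanAEC2009] VII.3.1(b),
VIII.§1; [Washington1997] §13.1; [Serre1973] Ch. II §3.1 Prop. 7; [Gouvea1993PadicNumbers] Prop. 4.6.1.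
-/

set_option autoImplicit false
-- the route's Theorems namespace repeats a component by design (summit = sub-problem, D-0017).
set_option linter.dupNamespace false

noncomputable section

open scoped Classical

open WeierstrassCurve Literature.NumberTheory.EllipticCurves Literature.NumberTheory.GaloisRepresentations
  Summit.BirchSwinnertonDyer.Rank1Residual.X5.O1 Summit.BirchSwinnertonDyer.Rank1Residual.X5.TowerGap

namespace Summit.BirchSwinnertonDyer.BirchSwinnertonDyer.Theorems.TowerClass

/-! ## §1 `Γ_{ℚ_ℓ}` restricts into `Gal(ℚ̄/ℚ(μ_N))` when `N ∣ ℓ − 1` -/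

section Padic

variable (ℓ : ℕ) [hℓ : Fact ℓ.Prime]

/-- **`res τ ∈ Gal(ℚ̄/ℚ(μ_N))` for every `τ ∈ Γ_{ℚ_ℓ}` when `N ∣ ℓ − 1`**: `ℚ_ℓ` contains a primitive
`N`-th root of unity `ζ` (Hensel; tree `padic_exists_isPrimitiveRoot_of_dvd`), so every `N`-th root of
unity of `ℚ̄_ℓ` is a power of `ζ`, fixed by `τ`; hence `ι(res τ • t) = τ(ι t) = ι t` for `tᴺ = 1`.
[cite: Serre1973, Ch. II §3.1 Prop. 7] [cite: Gouvea1993PadicNumbers, Prop. 4.6.1 (§4.6)] -/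
theorem resGalOfEmb_padic_mem_rootsOfUnityFixer {N : ℕ} (hN : N ∣ ℓ - 1)
    (ι : AlgebraicClosure ℚ →ₐ[ℚ] AlgebraicClosure ℚ_[ℓ]) (τ : Field.absoluteGaloisGroup ℚ_[ℓ]) :
    resGalOfEmb ι τ ∈ rootsOfUnityFixer ℚ N := by
  rw [mem_rootsOfUnityFixer_iff]
  intro t ht
  have hN0 : N ≠ 0 := by
    rintro rfl
    have h0 := Nat.eq_zero_of_zero_dvd hN
    have h2 := hℓ.out.two_le
    omega
  haveI : NeZero N := ⟨hN0⟩
  obtain ⟨ζ, hζ⟩ := Literature.NumberTheory.LocalFields.padic_exists_isPrimitiveRoot_of_dvd (p := ℓ) hN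
  have hζ' : IsPrimitiveRoot (algebraMap ℚ_[ℓ] (AlgebraicClosure ℚ_[ℓ]) ζ) N :=
    hζ.map_of_injective (algebraMap ℚ_[ℓ] (AlgebraicClosure ℚ_[ℓ])).injective
  have hιt : (ι t) ^ N = 1 := by rw [← map_pow, ht, map_one]
  obtain ⟨k, -, hk⟩ := hζ'.eq_pow_of_pow_eq_one hιt
  -- `ι (res τ • t) = τ • ι t` (defining property of `res`), and `τ` fixes `ι t = ζ^k ∈ ℚ_ℓ`
  have h := apply_resGalAuxOfEmb_apply ι τ t
  rw [← resGalOfEmb_apply] at h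
  have key : ι (resGalOfEmb ι τ • t) = τ • ι t := h
  have hfix : τ • ι t = ι t := by
    rw [← hk, ← map_pow, Field.absoluteGaloisGroup.smul_def, AlgEquiv.commutes]
  exact ι.toRingHom.injective (key.trans hfix)

end Padic

/-! ## §2 `E[p^∞]^S ↪ E(ℚ_ℓ)_tors` for `S ≥ Gal(ℚ̄/ℚ(μ_N))`, `N ∣ ℓ − 1`, `ℓ ≥ 3` good -/

section Rat

variable (W : WeierstrassCurve ℚ) [W.IsElliptic]

/-- **The descent step.** For a prime `ℓ ≥ 3` of good reduction, `N ∣ ℓ − 1`, a subgroup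
`S ≥ Gal(ℚ̄/ℚ(μ_N))` of `Γ_ℚ` and any prime `p`: every `S`-fixed point `m ∈ E[p^∞]` is, along the chosen
embedding `ι : ℚ̄ → ℚ̄_ℓ`, the image of a `ℚ_ℓ`-rational point `R` with `p^v • R = 0`,
`v = ord_p #E(ℚ_ℓ)_tors` (`ι_* m` is `Γ_{ℚ_ℓ}`-fixed by §1, then Galois descent over the perfect field
`ℚ_ℓ`; `R` is `p`-power torsion inside the finite group `E(ℚ_ℓ)_tors`). [cite: SilvermanAEC2009, VIII.§1 (proof of Prop. 1.2)] -/
theorem exists_point_padic_of_fixedBy [W.IsGloballyMinimal] (p ℓ : ℕ) [hp : Fact p.Prime] [Fact ℓ.Prime]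
    (h3 : 3 ≤ ℓ) (hgood : W.HasGoodReductionAtPrime ℓ) {N : ℕ} (hN : N ∣ ℓ - 1)
    {S : Subgroup (Field.absoluteGaloisGroup ℚ)} (hS : rootsOfUnityFixer ℚ N ≤ S)
    (m : geomPrimaryTorsion W p) (hm : ∀ σ ∈ S, σ • m = m) :
    ∃ R : (W.baseChange ℚ_[ℓ]).toAffine.Point,
      p ^ padicValNat p (Nat.card (AddCommGroup.torsion (W.baseChange ℚ_[ℓ]).toAffine.Point)) • R = 0 ∧
      W.baseChangeGeomPointsEquiv ℚ_[ℓ] (toGeomPoints (W.baseChange ℚ_[ℓ]) R) =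
        pointsMapOfEmb W (closureEmb (K := ℚ) ℚ_[ℓ]) (m : geomPoints W) := by
  haveI : PerfectField ℚ_[ℓ] := PerfectField.ofCharZero
  set ι : AlgebraicClosure ℚ →ₐ[ℚ] AlgebraicClosure ℚ_[ℓ] := closureEmb (K := ℚ) ℚ_[ℓ] with hι
  -- `#E(ℚ_ℓ)_tors ∣ #Ẽ(𝔽_ℓ)` (`c_ℓ = 1`), so `E(ℚ_ℓ)_tors` is finite
  have hd2 := Summit.BirchSwinnertonDyer.Rank1Residual.Additive.LocalLog.card_torsion_baseChange_dvd W ℓ h3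
  have hc : (W.baseChange ℚ_[ℓ]).localTamagawaNumber ℤ_[ℓ] = 1 := by
    haveI : ((W.baseChange ℚ_[ℓ]).minimal ℤ_[ℓ]).HasGoodReduction ℤ_[ℓ] := hgood
    exact localTamagawaNumber_eq_one_of_hasGoodReduction_holds ℤ_[ℓ] (W.baseChange ℚ_[ℓ])
  rw [hc, one_mul] at hd2
  haveI : NeZero ℓ := ⟨(Fact.out : ℓ.Prime).ne_zero⟩
  have hN0 : W.reductionPointCount ℓ ≠ 0 := (W.reductionPointCount_pos ℓ).ne'
  have hT0 : Nat.card (AddCommGroup.torsion (W.baseChange ℚ_[ℓ]).toAffine.Point) ≠ 0 :=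
    fun h ↦ hN0 (Nat.eq_zero_of_zero_dvd (h ▸ hd2))
  haveI hfinT : Finite (AddCommGroup.torsion (W.baseChange ℚ_[ℓ]).toAffine.Point) :=
    Nat.finite_of_card_ne_zero hT0
  set v := padicValNat p (Nat.card (AddCommGroup.torsion (W.baseChange ℚ_[ℓ]).toAffine.Point)) with hv
  -- the local point `Q = ι_* m` is `Γ_{ℚ_ℓ}`-fixed
  set Q : localPoints W ℚ_[ℓ] := pointsMapOfEmb W ι (m : geomPoints W) with hQ
  have hQfix : ∀ τ : Field.absoluteGaloisGroup ℚ_[ℓ], τ • Q = Q := fun τ ↦ by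
    have h1 : ((resGalOfEmb ι τ • m : geomPrimaryTorsion W p) : geomPoints W) = (m : geomPoints W) :=
      congrArg Subtype.val (hm _ (hS (resGalOfEmb_padic_mem_rootsOfUnityFixer ℓ hN ι τ)))
    rw [primaryComponent.coe_smul] at h1
    rw [hQ, ← pointsMapOfEmb_smul W ι τ, h1]
  -- transport to `(W⁄ℚ_ℓ)(ℚ̄_ℓ)` and descend
  set Q' : geomPoints (W.baseChange ℚ_[ℓ]) := (W.baseChangeGeomPointsEquiv ℚ_[ℓ]).symm Q with hQ'
  have hQ'fix : ∀ τ : Field.absoluteGaloisGroup ℚ_[ℓ], τ • Q' = Q' := fun τ ↦ by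
    rw [hQ', ← baseChangeGeomPointsEquiv_symm_smul, hQfix τ]
  obtain ⟨R, hR⟩ := exists_toGeomPoints_eq_of_forall_smul_eq (W := W.baseChange ℚ_[ℓ]) hQ'fix
  have hRQ : W.baseChangeGeomPointsEquiv ℚ_[ℓ] (toGeomPoints (W.baseChange ℚ_[ℓ]) R) = Q := by
    rw [hR, hQ', AddEquiv.apply_symm_apply]
  refine ⟨R, ?_, hRQ⟩
  -- `R` is `p`-power torsion: `p^k • m = 0 ⇒ p^k • R = 0`
  obtain ⟨k, hk⟩ := (AddCommGroup.mem_primaryComponent).mp (m : geomPrimaryTorsion W p).2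
  have hRk : p ^ k • R = 0 := by
    apply toGeomPoints_injective (W.baseChange ℚ_[ℓ])
    apply (W.baseChangeGeomPointsEquiv ℚ_[ℓ]).injective
    rw [map_nsmul, map_nsmul, hRQ, hQ, ← map_nsmul, hk, map_zero, map_zero, map_zero]
  -- `addOrderOf R = p^i` with `p^i ∣ #E(ℚ_ℓ)_tors`, so `i ≤ v`
  have hfin : IsOfFinAddOrder R := isOfFinAddOrder_iff_nsmul_eq_zero.mpr ⟨p ^ k, pow_pos hp.out.pos _, hRk⟩
  obtain ⟨i, -, hi⟩ := (Nat.dvd_prime_pow hp.out).mp (addOrderOf_dvd_of_nsmul_eq_zero hRk)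
  have hmemT : R ∈ AddCommGroup.torsion (W.baseChange ℚ_[ℓ]).toAffine.Point := by
    rw [AddCommGroup.mem_torsion]; exact hfin
  have hiT : p ^ i ∣ Nat.card (AddCommGroup.torsion (W.baseChange ℚ_[ℓ]).toAffine.Point) := by
    rw [← hi, ← AddSubgroup.addOrderOf_mk R hmemT]
    exact addOrderOf_dvd_natCard _
  have hiv : i ≤ v := (padicValNat_dvd_iff_le hT0).mp hiT
  exact addOrderOf_dvd_iff_nsmul_eq_zero.mp (hi ▸ pow_dvd_pow p hiv)

/-- **`#E[p^∞]^S ≤ p^{ord_p #Ẽ(𝔽_ℓ)}` for every subgroup `S ≥ Gal(ℚ̄/ℚ(μ_N))` of `Γ_ℚ`**, at a prime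
`ℓ ≥ 3` of good reduction with `N ∣ ℓ − 1` (and the fixed set is finite): the `S`-fixed points of
`E[p^∞]` inject (`exists_point_padic_of_fixedBy`) into `E(ℚ_ℓ)[p^v]`, `v = ord_p #E(ℚ_ℓ)_tors`, a
`p`-group inside `E(ℚ_ℓ)_tors`, whose order divides `#E(ℚ_ℓ)_tors ∣ c_ℓ · #Ẽ_ns(𝔽_ℓ) = #Ẽ(𝔽_ℓ)`.
[cite: SilvermanAEC2009, VII.3 Prop. 3.1(b) and VIII.§1] [cite: Serre1973, Ch. II §3.1 Prop. 7] -/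
theorem finite_and_natCard_fixedBy_le_pow_of_rootsOfUnityFixer_le [W.IsGloballyMinimal] (p ℓ : ℕ)
    [hp : Fact p.Prime] [Fact ℓ.Prime] (h3 : 3 ≤ ℓ) (hgood : W.HasGoodReductionAtPrime ℓ) {N : ℕ}
    (hN : N ∣ ℓ - 1) {S : Subgroup (Field.absoluteGaloisGroup ℚ)} (hS : rootsOfUnityFixer ℚ N ≤ S) :
    Finite {m : geomPrimaryTorsion W p | ∀ σ ∈ S, σ • m = m} ∧
      Nat.card {m : geomPrimaryTorsion W p | ∀ σ ∈ S, σ • m = m} ≤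
        p ^ padicValNat p (W.reductionPointCount ℓ) := by
  -- `#E(ℚ_ℓ)_tors ∣ #Ẽ(𝔽_ℓ)`
  have hd2 := Summit.BirchSwinnertonDyer.Rank1Residual.Additive.LocalLog.card_torsion_baseChange_dvd W ℓ h3
  have hc : (W.baseChange ℚ_[ℓ]).localTamagawaNumber ℤ_[ℓ] = 1 := by
    haveI : ((W.baseChange ℚ_[ℓ]).minimal ℤ_[ℓ]).HasGoodReduction ℤ_[ℓ] := hgood
    exact localTamagawaNumber_eq_one_of_hasGoodReduction_holds ℤ_[ℓ] (W.baseChange ℚ_[ℓ])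
  rw [hc, one_mul] at hd2
  haveI : NeZero ℓ := ⟨(Fact.out : ℓ.Prime).ne_zero⟩
  have hN0 : W.reductionPointCount ℓ ≠ 0 := (W.reductionPointCount_pos ℓ).ne'
  have hT0 : Nat.card (AddCommGroup.torsion (W.baseChange ℚ_[ℓ]).toAffine.Point) ≠ 0 :=
    fun h ↦ hN0 (Nat.eq_zero_of_zero_dvd (h ▸ hd2))
  haveI hfinT : Finite (AddCommGroup.torsion (W.baseChange ℚ_[ℓ]).toAffine.Point) :=
    Nat.finite_of_card_ne_zero hT0
  set v := padicValNat p (Nat.card (AddCommGroup.torsion (W.baseChange ℚ_[ℓ]).toAffine.Point)) with hv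
  have hvle : v ≤ padicValNat p (W.reductionPointCount ℓ) :=
    (padicValNat_dvd_iff_le hN0).mp (pow_padicValNat_dvd.trans hd2)
  -- `H = E(ℚ_ℓ)[p^v]`, a `p`-group inside `E(ℚ_ℓ)_tors`: `#H = p^j`, `j ≤ v`
  let H : AddSubgroup (W.baseChange ℚ_[ℓ]).toAffine.Point :=
    (DistribSMul.toAddMonoidHom (W.baseChange ℚ_[ℓ]).toAffine.Point (p ^ v)).ker
  have hH : ∀ P, P ∈ H ↔ p ^ v • P = 0 := fun P ↦ by
    simp only [H, AddMonoidHom.mem_ker, DistribSMul.toAddMonoidHom_apply]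
  have hHT : H ≤ AddCommGroup.torsion (W.baseChange ℚ_[ℓ]).toAffine.Point := fun P hP ↦ by
    rw [AddCommGroup.mem_torsion]
    exact isOfFinAddOrder_iff_nsmul_eq_zero.mpr ⟨p ^ v, pow_pos hp.out.pos _, (hH P).mp hP⟩
  haveI hfinH : Finite H := Finite.of_injective _ (AddSubgroup.inclusion_injective hHT)
  have hpg : IsPGroup p (Multiplicative H) := fun g ↦ ⟨v, by
    apply Multiplicative.toAdd.injective
    rw [toAdd_pow, toAdd_one]
    exact Subtype.ext (by
      rw [AddSubgroup.coe_nsmul, AddSubgroup.coe_zero]; exact (hH _).mp (Multiplicative.toAdd g).2)⟩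
  obtain ⟨j, hj⟩ := IsPGroup.iff_card.mp hpg
  have hjH : Nat.card H = p ^ j := by
    rw [← hj]; exact Nat.card_congr Multiplicative.ofAdd
  have hdvd : p ^ j ∣ Nat.card (AddCommGroup.torsion (W.baseChange ℚ_[ℓ]).toAffine.Point) := by
    rw [← hjH]; exact AddSubgroup.card_dvd_of_le hHT
  have hjv : j ≤ v := (padicValNat_dvd_iff_le hT0).mp hdvd
  -- the injection `E[p^∞]^S ↪ H`
  have hdesc := fun m : {m : geomPrimaryTorsion W p | ∀ σ ∈ S, σ • m = m} ↦
    exists_point_padic_of_fixedBy W p ℓ h3 hgood hN hS (m : geomPrimaryTorsion W p) m.2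
  let f : {m : geomPrimaryTorsion W p | ∀ σ ∈ S, σ • m = m} → H :=
    fun m ↦ ⟨(hdesc m).choose, (hH _).mpr (hdesc m).choose_spec.1⟩
  have hf : Function.Injective f := fun m m' hmm' ↦ by
    have h1 := (hdesc m).choose_spec.2
    have h2 := (hdesc m').choose_spec.2
    have heq : (hdesc m).choose = (hdesc m').choose :=
      congrArg (fun x : H ↦ (x : (W.baseChange ℚ_[ℓ]).toAffine.Point)) hmm'
    rw [heq, h2] at h1
    exact Subtype.ext (Subtype.ext (pointsMapOfEmb_injective W _ h1.symm))
  refine ⟨Finite.of_injective f hf, ?_⟩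
  calc Nat.card {m : geomPrimaryTorsion W p | ∀ σ ∈ S, σ • m = m}
      ≤ Nat.card H := Nat.card_le_card_of_injective f hf
    _ = p ^ j := hjH
    _ ≤ p ^ v := Nat.pow_le_pow_right hp.out.pos hjv
    _ ≤ p ^ padicValNat p (W.reductionPointCount ℓ) := Nat.pow_le_pow_right hp.out.pos hvle

/-- **`#E[p^∞]^{Gal(ℚ̄/ℚ(μ_N))} ≤ p^{ord_p #Ẽ(𝔽_ℓ)}`** (`ℓ ≥ 3` good, `N ∣ ℓ − 1`): the `p`-power torsion
of `E` rational over `ℚ(μ_N)` embeds in `Ẽ(𝔽_ℓ)` (`ℓ` splits completely in `ℚ(μ_N)`).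
[cite: SilvermanAEC2009, VII.3 Prop. 3.1(b) and VIII.§1] [cite: Serre1973, Ch. II §3.1 Prop. 7] -/
theorem natCard_fixedBy_rootsOfUnityFixer_le_pow [W.IsGloballyMinimal] (p ℓ : ℕ) [Fact p.Prime]
    [Fact ℓ.Prime] (h3 : 3 ≤ ℓ) (hgood : W.HasGoodReductionAtPrime ℓ) {N : ℕ} (hN : N ∣ ℓ - 1) :
    Nat.card {m : geomPrimaryTorsion W p | ∀ σ ∈ rootsOfUnityFixer ℚ N, σ • m = m} ≤
      p ^ padicValNat p (W.reductionPointCount ℓ) :=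
  (finite_and_natCard_fixedBy_le_pow_of_rootsOfUnityFixer_le W p ℓ h3 hgood hN le_rfl).2

/-! ## §3 The displayed layer-`j` torsion count `htor` of the tower doors, discharged -/

/-- **The layer-`j` torsion certificate**: for every cyclotomic `ℤ₂`-extension `κ` of `ℚ`, a prime
`ℓ ≥ 3` of good reduction with `2^{j+2} ∣ ℓ − 1` and `ord₂ #Ẽ(𝔽_ℓ) ≤ t` gives
`#{m ∈ E[2^∞] : σ m = m ∀ σ ∈ Gal(ℚ̄/ℚ_j)} ≤ 2^t` — `Gal(ℚ̄/ℚ_j) ≥ Gal(ℚ̄/ℚ(μ_{2^{j+2}}))`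
(`ℚ_j = ℚ(ζ_{2^{j+2}})⁺`, tree `IsCyclotomic.rootsOfUnityFixer_le_layerSubgroup_two`) and §2. This is the
binder `htor` of `towerGapAtTwo_of_counts_of_torsion[_print]` and of mult-2's `…_of_torsion` doors.
[cite: Washington1997, §13.1] [cite: SilvermanAEC2009, VII.3 Prop. 3.1(b) and VIII.§1] -/
theorem natCard_fixedBy_layerSubgroup_le_pow_of_good [W.IsGloballyMinimal] (κ : ZpExtension ℚ 2)
    (hκ : κ.IsCyclotomic) (j ℓ : ℕ) [Fact ℓ.Prime] (h3 : 3 ≤ ℓ) (hgood : W.HasGoodReductionAtPrime ℓ)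
    (hℓ1 : 2 ^ (j + 2) ∣ ℓ - 1) {t : ℕ} (hℓ : padicValNat 2 (W.reductionPointCount ℓ) ≤ t) :
    Nat.card {m : geomPrimaryTorsion W 2 | ∀ σ ∈ κ.layerSubgroup j, σ • m = m} ≤ 2 ^ t :=
  (finite_and_natCard_fixedBy_le_pow_of_rootsOfUnityFixer_le W 2 ℓ h3 hgood hℓ1
    (hκ.rootsOfUnityFixer_le_layerSubgroup_two j)).2.trans (Nat.pow_le_pow_right two_pos hℓ)

/-- The same for ALL cyclotomic `κ` at once, in the verbatim binder shape `htor`. [cite: Washington1997, §13.1]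
[cite: SilvermanAEC2009, VII.3 Prop. 3.1(b) and VIII.§1] -/
theorem htor_layer_of_good [W.IsGloballyMinimal] (j ℓ : ℕ) [Fact ℓ.Prime] (h3 : 3 ≤ ℓ)
    (hgood : W.HasGoodReductionAtPrime ℓ) (hℓ1 : 2 ^ (j + 2) ∣ ℓ - 1) {t : ℕ}
    (hℓ : padicValNat 2 (W.reductionPointCount ℓ) ≤ t) :
    ∀ κ : ZpExtension ℚ 2, κ.IsCyclotomic →
      Nat.card {m : geomPrimaryTorsion W 2 | ∀ σ ∈ κ.layerSubgroup j, σ • m = m} ≤ 2 ^ t :=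
  fun κ hκ ↦ natCard_fixedBy_layerSubgroup_le_pow_of_good W κ hκ j ℓ h3 hgood hℓ1 hℓ

/-- **Decidable reading**: `#Ẽ(𝔽_ℓ) = n` and `¬ 2^{t+1} ∣ n` (so `ord₂ n ≤ t`) in place of the valuation
bound. [cite: SilvermanAEC2009, VII.3 Prop. 3.1(b) and VIII.§1] -/
theorem htor_layer_of_good_card [W.IsGloballyMinimal] (j ℓ : ℕ) [Fact ℓ.Prime] (h3 : 3 ≤ ℓ)
    (hgood : W.HasGoodReductionAtPrime ℓ) (hℓ1 : 2 ^ (j + 2) ∣ ℓ - 1) {t n : ℕ}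
    (hn : W.reductionPointCount ℓ = n) (hndvd : ¬ 2 ^ (t + 1) ∣ n) :
    ∀ κ : ZpExtension ℚ 2, κ.IsCyclotomic →
      Nat.card {m : geomPrimaryTorsion W 2 | ∀ σ ∈ κ.layerSubgroup j, σ • m = m} ≤ 2 ^ t := by
  haveI : NeZero ℓ := ⟨(Fact.out : ℓ.Prime).ne_zero⟩
  have hn0 : n ≠ 0 := hn ▸ (reductionPointCount_pos W ℓ).ne'
  exact htor_layer_of_good W j ℓ h3 hgood hℓ1 (hn ▸ padicValNat_le_of_not_pow_succ_dvd hn0 hndvd)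

/-! ## §4 The torsion-tolerant gap door at a general pair `(j, j')`, torsion count discharged -/

/-- **Gap from `(j, j')` counts with rational `2`-torsion, the layer-`j` torsion count from a good prime
`ℓ ≡ 1 (mod 2^{j+2})`**: PRINT `hB` (finiteness of `E(ℚ_∞)[2^∞]`, Greenberg LNM 1716 §1) + CERT
{`2^a ≤ #Sel_{2^∞}(E/ℚ_j)[2]`, `#A_{j'}[2] ≤ 2^d`, `ℓ ≥ 3` good with `2^{j+2} ∣ ℓ − 1` and
`ord₂ #Ẽ(𝔽_ℓ) ≤ t`, `d + t + 1 ≤ 2^{j'} − 2^j + a`} ⇒ `O1.TowerGapAtTwo W`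
(`…TowerLayerTorsion.towerGapAtTwo_of_counts_of_torsion_print` with `htor` := §3).
[cite: GreenbergLNM1716, §1 p. 60 and p. 62, §3 pp. 85–86, §4 Lemma 4.3] [cite: Washington1997, §13.1]
[cite: SilvermanAEC2009, VII.3 Prop. 3.1(b)] -/
theorem towerGapAtTwo_of_counts_of_goodPrime_layer [W.IsGloballyMinimal]
    (hB : Greenberg1999.finite_torsion_cyclotomicZpExtension) {j j' a d t : ℕ} (hjj' : j ≤ j')
    (ℓ : ℕ) [Fact ℓ.Prime] (h3 : 3 ≤ ℓ) (hgood : W.HasGoodReductionAtPrime ℓ) (hℓ1 : 2 ^ (j + 2) ∣ ℓ - 1)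
    (hℓ : padicValNat 2 (W.reductionPointCount ℓ) ≤ t)
    (hlow : ∀ κ : ZpExtension ℚ 2, κ.IsCyclotomic →
      2 ^ a ≤ Nat.card {z : W.selmerLayer κ j // 2 • z = 0})
    (hup : ∀ κ : ZpExtension ℚ 2, κ.IsCyclotomic →
      Nat.card {z : W.selmerInftyPreimage κ j' // 2 • z = 0} ≤ 2 ^ d)
    (had : d + t + 1 ≤ 2 ^ j' - 2 ^ j + a) : TowerGapAtTwo W :=
  towerGapAtTwo_of_counts_of_torsion_print W hB hjj' hlow (htor_layer_of_good W j ℓ h3 hgood hℓ1 hℓ)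
    hup had

/-- **The same door with every torsion datum decidable**: `#Ẽ(𝔽_ℓ) = n`, `¬ 2^{t+1} ∣ n`.
[cite: GreenbergLNM1716, §1 p. 60 and p. 62, §3 pp. 85–86, §4 Lemma 4.3] [cite: Washington1997, §13.1]
[cite: SilvermanAEC2009, VII.3 Prop. 3.1(b)] -/
theorem towerGapAtTwo_of_counts_of_goodPrime_layer_card [W.IsGloballyMinimal]
    (hB : Greenberg1999.finite_torsion_cyclotomicZpExtension) {j j' a d t n : ℕ} (hjj' : j ≤ j')
    (ℓ : ℕ) [Fact ℓ.Prime] (h3 : 3 ≤ ℓ) (hgood : W.HasGoodReductionAtPrime ℓ) (hℓ1 : 2 ^ (j + 2) ∣ ℓ - 1)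
    (hn : W.reductionPointCount ℓ = n) (hndvd : ¬ 2 ^ (t + 1) ∣ n)
    (hlow : ∀ κ : ZpExtension ℚ 2, κ.IsCyclotomic →
      2 ^ a ≤ Nat.card {z : W.selmerLayer κ j // 2 • z = 0})
    (hup : ∀ κ : ZpExtension ℚ 2, κ.IsCyclotomic →
      Nat.card {z : W.selmerInftyPreimage κ j' // 2 • z = 0} ≤ 2 ^ d)
    (had : d + t + 1 ≤ 2 ^ j' - 2 ^ j + a) : TowerGapAtTwo W :=
  towerGapAtTwo_of_counts_of_torsion_print W hB hjj' hlow
    (htor_layer_of_good_card W j ℓ h3 hgood hℓ1 hn hndvd) hup had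

end Rat

end Summit.BirchSwinnertonDyer.BirchSwinnertonDyer.Theorems.TowerClass

end
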